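import Literature.Computability.QuantumComplexity.ZXCalculusForkAbsorbs
import HarnessLib

/-!
# ZX-calculus, Layer T9: Appendix Lemma 33 (the symmetric diagram with a triangle and a Hadamard)

[cite: JeandelPerdrixVilmart2018, Appendix Lemma 33]: `Z^{(1,2)} ⨾ ((T ⨾ H) ⊗ (Tᵗ ⨾ Z^{(1,0)})) = √2 ⊗ (X(π) ⨾ T)`.
Own route (the printed proof goes through an expression of `H` by triangles): the triangle without its
gadget satisfies `N ⨾ H = X(π) ⨾ N` (Euler, (K)), the pendant effect `Tᵗ ⨾ Z^{(1,0)}` is a gadget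
proportional to the triangle's own gadget, and the two gadgets cancel against the third through `X(π)`
(`gadgetNode_pi_seq_gadgetNode`).
-/

namespace Literature.Computability.QuantumComplexity

open ZXDiagram

namespace ZXClass

/-- The red–green–red Euler decomposition: `H = 1/√2 ⊗ Z^{(0,0)}(-π/2) ⊗ (X(π/2) ⨾ Z(π/2) ⨾ X(π/2))`.
[cite: JeandelPerdrixVilmart2018, Appendix Lemma 16] -/
theorem hBox_eq_euler_red : mk hBox = mk invSqrtTwo ⊠ (mk (Z 0 0 (-2)) ⊠ (mk (X 1 1 2) ⨟ mk (Z 1 1 2) ⨟ mk (X 1 1 2))) := by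
  have h := congrArg colorSwap hBox_eq_euler
  simp only [colorSwap_mk, colorSwap_par, colorSwap_seq, ZXDiagram.colorSwap_hBox, ZXDiagram.colorSwap_Z, ZXDiagram.colorSwap_X] at h
  rw [X_dot_eq_Z_dot, show mk invSqrtTwo.colorSwap = mk invSqrtTwo from by
    simp only [invSqrtTwo, ZXDiagram.colorSwap_seq, ZXDiagram.colorSwap_Z, ZXDiagram.colorSwap_X, mk_seq]; exact invSqrtTwo_eq_red.symm] at h
  exact h

/-- **The triangle without its gadget and the Hadamard**: `N ⨾ H = X(π) ⨾ N` with `N = xLeafL 0 (π/4) ⨾ Z(π/4) ⨾ X(π/2)`.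
[cite: JeandelPerdrixVilmart2018, Appendix Lemma 33 (proof)] -/
theorem leafN_seq_hBox : (mk (xLeafL 0 1) ⨟ mk (Z 1 1 1) ⨟ mk (X 1 1 2)) ⨟ mk hBox = mk (X 1 1 4) ⨟ (mk (xLeafL 0 1) ⨟ mk (Z 1 1 1) ⨟ mk (X 1 1 2)) := by
  rw [hBox_eq_euler_red, Z_dot_neg_two_eq, seq_scalar_par_one, seq_scalar_par_one]
  simp only [seq_assoc]
  rw [← seq_assoc (mk (X 1 1 2)) (mk (X 1 1 2)), xphase_seq_xphase, show (2 : ZMod 8) + 2 = 4 from by decide,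
    ← seq_assoc (mk (X 1 1 4)) (mk (xLeafL 0 1)), X_pi_seq_xLeafL]
  -- `db 4 (-1) ⊗ (Z(π/4) ⨾ X(π)) = √2/√2… `: use (K) in the form `√2 ⊗ (Z(π/4) ⨾ X(π)) = db 4 1 ⊗ (X(π) ⨾ Z(-π/4))`
  refine cancel_sqrt_two_left ?_
  rw [scalar_par_scalar_par (mk (dumbbell 0 0)) (mk invSqrtTwo), scalar_par_scalar_par (mk (dumbbell 0 0)) (mk (dumbbell 4 (-1))),
    ← seq_scalar_par_one (mk (dumbbell 0 0)) (mk (xLeafL 0 1)), ← seq_assoc (mk (Z 1 1 1)) (mk (X 1 1 4)),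
    ← scalar_par_seq_one (mk (dumbbell 0 0)) (mk (Z 1 1 1) ⨟ mk (X 1 1 4)), sqrt_two_par_Z_phase_seq_X_pi, scalar_par_seq_one, seq_scalar_par_one,
    seq_assoc (mk (X 1 1 4)), ← seq_assoc (mk (xLeafL 0 1)) (mk (X 1 1 4)), xLeafL_zero_seq_X_pi, ← seq_assoc (mk (Z 1 1 (-1))) (mk (Z 1 1 2)), phase_seq_phase,
    show (-1 : ZMod 8) + 2 = 1 from by decide, scalar_par_scalar_par (mk (dumbbell 4 (-1))) (mk (dumbbell 4 1)),
    show ∀ Y : ZXClass 1 1, mk (dumbbell 4 1) ⊠ (mk (dumbbell 4 (-1)) ⊠ Y) = (mk (dumbbell 4 1) ⊠ mk (dumbbell 4 (-1))) ⊠ Y from fun Y => (par_assoc' _ _ _).trans (cast_id _ _ _),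
    dumbbell_four_mul, show (1 : ZMod 8) + -1 = 0 from by decide, dumbbell_four_zero,
    show ∀ Y : ZXClass 1 1, (mk (dumbbell 0 0) ⊠ mk (dumbbell 0 0)) ⊠ Y = mk (dumbbell 0 0) ⊠ (mk (dumbbell 0 0) ⊠ Y) from fun Y => (par_assoc _ _ _).trans (cast_id _ _ _),
    scalar_par_scalar_par (mk invSqrtTwo) (mk (dumbbell 0 0)), invSqrtTwo_par_sqrt_two_par_one]

/-- Angle deletion by the red `0`-effect: `Z(α) ⨾ X^{(1,0)} = X^{(1,0)}`. [cite: JeandelPerdrixVilmart2018, Fig. 1 (B1)] -/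
theorem Z_phase_seq_X_effect_zero (a : ZMod 8) : mk (Z 1 1 a) ⨟ mk (X 1 0 0) = mk (X 1 0 0) := by
  have h := congrArg transpose (X_state_zero_seq_Z_phase a)
  simpa using h

/-- Angle deletion by the green `0`-effect: `X(α) ⨾ Z^{(1,0)} = Z^{(1,0)}`. [cite: JeandelPerdrixVilmart2018, Fig. 1 (B1)] -/
theorem X_phase_seq_Z_effect_zero (a : ZMod 8) : mk (X 1 1 a) ⨟ mk (Z 1 0 0) = mk (Z 1 0 0) := by
  have h := congrArg colorSwap (Z_phase_seq_X_effect_zero a)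
  simpa using h

/-- The triangle followed by the green `0`-effect is its green node with the `(π/4, π/4)` gadget:
`T ⨾ Z^{(1,0)} = Gn ⨾ X^{(1,2)} ⨾ (Z^{(1,0)}(π/4))^{⊗2}`. [cite: JeandelPerdrixVilmart2018, Appendix Lemma 33 (proof)] -/
theorem triangle_seq_Z_effect : mk triangle ⨟ mk (Z 1 0 0) = (mk (Z 1 2 0) ⨟ (mk (wires 1) ⊠ (mk (X 1 2 0) ⨟ (mk (Z 1 0 (-1)) ⊠ mk (Z 1 0 (-1)))))) ⨟ (mk (X 1 2 0) ⨟ (mk (Z 1 0 1) ⊠ mk (Z 1 0 1))) := by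
  rw [mk_triangle, seq_assoc, X_phase_seq_Z_effect_zero, seq_assoc, Z_seq_Z 1 1 0 le_rfl, add_zero (1 : ZMod 8), seq_assoc]
  simp only [xLeafL, mk_seq, mk_par]
  rw [seq_assoc (mk (X 1 2 0)) (mk (Z 1 0 1) ⊠ mk (wires 1)) (mk (Z 1 0 1)), par_eq_seq_left (mk (Z 1 0 1)) (mk (Z 1 0 1)), empty_par, cast_id]

/-- A scalar between a `1 → 2` map and a `2 → 0` effect floats out. [folklore] -/
theorem one_two_seq_scalar_par_zero (A : ZXClass 1 2) (s : ZXClass 0 0) (B : ZXClass 2 0) : A ⨟ (s ⊠ B) = s ⊠ (A ⨟ B) := by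
  rw [scalar_par_seq_right, empty_par, cast_id]

/-- A scalar commutes past an effect. [folklore] -/
theorem scalar_par_effect_comm (t : ZXClass 0 0) (A : ZXClass 1 0) : t ⊠ A = A ⊠ t := by
  rw [par_eq_seq_right t A, par_eq_seq_left A t, empty_par, par_empty, par_empty, empty_par, cast_id, cast_id]

/-- Scalars on two parallel effects float out. [folklore] -/
theorem scalar_par_effect_par_scalar_par_effect (s t : ZXClass 0 0) (A B : ZXClass 1 0) : (s ⊠ A) ⊠ (t ⊠ B) = s ⊠ (t ⊠ (A ⊠ B)) := by
  rw [show (s ⊠ A) ⊠ (t ⊠ B) = s ⊠ (A ⊠ (t ⊠ B)) from (par_assoc _ _ _).trans (cast_id _ _ _),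
    show A ⊠ (t ⊠ B) = (A ⊠ t) ⊠ B from (par_assoc' _ _ _).trans (cast_id _ _ _), ← scalar_par_effect_comm,
    show (t ⊠ A) ⊠ B = t ⊠ (A ⊠ B) from (par_assoc _ _ _).trans (cast_id _ _ _)]

/-- **The `(π/4, π/4)` gadget is proportional to the triangle's gadget**: `db 4 (-1) ⊗ db 4 (-1) ⊗ Gn₊ = √2 ⊗ √2 ⊗ Gn` ((K) on both leaves).
[cite: JeandelPerdrixVilmart2018, Appendix Lemmas 6, 33] -/
theorem gadgetNode_plus_eq : mk (dumbbell 4 (-1)) ⊠ (mk (dumbbell 4 (-1)) ⊠ (mk (Z 1 2 0) ⨟ (mk (wires 1) ⊠ (mk (X 1 2 0) ⨟ (mk (Z 1 0 1) ⊠ mk (Z 1 0 1)))))) = mk (dumbbell 0 0) ⊠ (mk (dumbbell 0 0) ⊠ (mk (Z 1 2 0) ⨟ (mk (wires 1) ⊠ (mk (X 1 2 0) ⨟ (mk (Z 1 0 (-1)) ⊠ mk (Z 1 0 (-1))))))) := by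
  have hflip : mk (dumbbell 4 (-1)) ⊠ mk (Z 1 0 1) = mk (dumbbell 0 0) ⊠ (mk (X 1 1 4) ⨟ mk (Z 1 0 (-1))) := by
    simpa using (sqrt_two_par_X_pi_seq_Z_effect (-1)).symm
  have hsc : ∀ (t : ZXClass 0 0) (F : ZXClass 1 0), t ⊠ (mk (wires 1) ⊠ F) = mk (wires 1) ⊠ (t ⊠ F) := fun t F => by
    rw [show mk (wires 1) ⊠ (t ⊠ F) = (mk (wires 1) ⊠ t) ⊠ F from (par_assoc' _ _ _).trans (cast_id _ _ _), ← scalar_par_one_comm]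
    exact (par_assoc' _ _ _).trans (cast_id _ _ _)
  have hX : mk (X 1 2 0) ⨟ (mk (X 1 1 4) ⊠ mk (X 1 1 4)) = mk (X 1 2 0) := by
    have h := congrArg colorSwap (show mk (Z 1 2 0) ⨟ (mk (Z 1 1 4) ⊠ mk (Z 1 1 4)) = mk (Z 1 2 0) from by
      rw [par_eq_seq_left (mk (Z 1 1 4)) (mk (Z 1 1 4)), ← seq_assoc, Z_seq_Z_par 1 1 1 1 le_rfl, add_zero, Z_seq_par_Z 1 1 1 1 le_rfl,
        show (4 : ZMod 8) + 4 = 0 from by decide])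
    simpa using h
  rw [← one_two_seq_scalar_par_one, ← one_two_seq_scalar_par_one, hsc, hsc, ← one_two_seq_scalar_par_zero, ← one_two_seq_scalar_par_zero,
    ← scalar_par_effect_par_scalar_par_effect, hflip, scalar_par_effect_par_scalar_par_effect, ← interchange,
    one_two_seq_scalar_par_zero, one_two_seq_scalar_par_zero, ← seq_assoc (mk (X 1 2 0)), hX, ← hsc, ← hsc, one_two_seq_scalar_par_one, one_two_seq_scalar_par_one]

/-- A red `π` on the second output of the copy. [cite: JeandelPerdrixVilmart2018, Fig. 1 (K1)] -/
theorem split_seq_par_X_pi : mk (Z 1 2 0) ⨟ (mk (wires 1) ⊠ mk (X 1 1 4)) = mk (X 1 1 4) ⨟ mk (Z 1 2 0) ⨟ (mk (X 1 1 4) ⊠ mk (wires 1)) := by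
  rw [K1_red, seq_assoc, par_eq_seq_right (mk (X 1 1 4)) (mk (X 1 1 4)), seq_assoc, ← seq_par_wires, xphase_seq_xphase,
    show (4 : ZMod 8) + 4 = 0 from by decide, X_one_one, wires_par_wires, seq_id]

/-- **Appendix Lemma 33** (`symmetric-diagram-with-triangle-hadamard`):
`Z^{(1,2)} ⨾ ((T ⨾ H) ⊗ (Tᵗ ⨾ Z^{(1,0)})) = √2 ⊗ (X(π) ⨾ T)`. [cite: JeandelPerdrixVilmart2018, Appendix Lemma 33] -/
theorem split_seq_triangle_hBox_par_pendant :
    mk (Z 1 2 0) ⨟ ((mk triangle ⨟ mk hBox) ⊠ ((mk triangle).transpose ⨟ mk (Z 1 0 0))) = mk (dumbbell 0 0) ⊠ (mk (X 1 1 4) ⨟ mk triangle) := by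
  -- the pendant is `X(π) ⨾ Gn ⨾ G₊`, and moves in front of the copy
  have hE : (mk triangle).transpose ⨟ mk (Z 1 0 0) = mk (X 1 1 4) ⨟ ((mk (Z 1 2 0) ⨟ (mk (wires 1) ⊠ (mk (X 1 2 0) ⨟ (mk (Z 1 0 (-1)) ⊠ mk (Z 1 0 (-1)))))) ⨟ (mk (X 1 2 0) ⨟ (mk (Z 1 0 1) ⊠ mk (Z 1 0 1)))) := by
    rw [triangle_transpose_eq, seq_assoc, seq_assoc, X_phase_pi_seq_Z_effect, triangle_seq_Z_effect]
  have hsc : ∀ (t : ZXClass 0 0) (F : ZXClass 1 0), t ⊠ (mk (wires 1) ⊠ F) = mk (wires 1) ⊠ (t ⊠ F) := fun t F => by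
    rw [show mk (wires 1) ⊠ (t ⊠ F) = (mk (wires 1) ⊠ t) ⊠ F from (par_assoc' _ _ _).trans (cast_id _ _ _), ← scalar_par_one_comm]
    exact (par_assoc' _ _ _).trans (cast_id _ _ _)
  rw [hE, par_eq_seq_right (mk triangle ⨟ mk hBox), par_empty, wires_par_seq, wires_par_seq, ← seq_assoc (mk (Z 1 2 0)),
    ← seq_assoc (mk (Z 1 2 0)), split_seq_par_X_pi, seq_assoc (mk (X 1 1 4) ⨟ mk (Z 1 2 0)) (mk (X 1 1 4) ⊠ mk (wires 1)),
    ← seq_assoc (mk (X 1 1 4) ⊠ mk (wires 1)) (mk (wires 1) ⊠ (mk (Z 1 2 0) ⨟ (mk (wires 1) ⊠ (mk (X 1 2 0) ⨟ (mk (Z 1 0 (-1)) ⊠ mk (Z 1 0 (-1))))))) (mk (wires 1) ⊠ (mk (X 1 2 0) ⨟ (mk (Z 1 0 1) ⊠ mk (Z 1 0 1)))),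
    show (mk (X 1 1 4) ⊠ mk (wires 1)) ⨟ (mk (wires 1) ⊠ (mk (Z 1 2 0) ⨟ (mk (wires 1) ⊠ (mk (X 1 2 0) ⨟ (mk (Z 1 0 (-1)) ⊠ mk (Z 1 0 (-1))))))) = (mk (wires 1) ⊠ (mk (Z 1 2 0) ⨟ (mk (wires 1) ⊠ (mk (X 1 2 0) ⨟ (mk (Z 1 0 (-1)) ⊠ mk (Z 1 0 (-1))))))) ⨟ (mk (X 1 1 4) ⊠ mk (wires 1)) from by rw [← par_eq_seq_left, ← par_eq_seq_right],
    seq_assoc (mk (wires 1) ⊠ (mk (Z 1 2 0) ⨟ (mk (wires 1) ⊠ (mk (X 1 2 0) ⨟ (mk (Z 1 0 (-1)) ⊠ mk (Z 1 0 (-1))))))) (mk (X 1 1 4) ⊠ mk (wires 1)) (mk (wires 1) ⊠ (mk (X 1 2 0) ⨟ (mk (Z 1 0 1) ⊠ mk (Z 1 0 1)))),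
    show (mk (X 1 1 4) ⊠ mk (wires 1)) ⨟ (mk (wires 1) ⊠ (mk (X 1 2 0) ⨟ (mk (Z 1 0 1) ⊠ mk (Z 1 0 1)))) = (mk (wires 1) ⊠ (mk (X 1 2 0) ⨟ (mk (Z 1 0 1) ⊠ mk (Z 1 0 1)))) ⨟ mk (X 1 1 4)
      from by rw [← par_eq_seq_left, par_eq_seq_right (mk (X 1 1 4)), par_empty],
    ← seq_assoc (mk (X 1 1 4) ⨟ mk (Z 1 2 0)) (mk (wires 1) ⊠ (mk (Z 1 2 0) ⨟ (mk (wires 1) ⊠ (mk (X 1 2 0) ⨟ (mk (Z 1 0 (-1)) ⊠ mk (Z 1 0 (-1))))))), seq_assoc (mk (X 1 1 4)) (mk (Z 1 2 0)) (mk (wires 1) ⊠ (mk (Z 1 2 0) ⨟ (mk (wires 1) ⊠ (mk (X 1 2 0) ⨟ (mk (Z 1 0 (-1)) ⊠ mk (Z 1 0 (-1))))))), split_seq_par_gadget]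
  simp only [seq_assoc]
  rw [← seq_assoc (mk (Z 1 2 0)) (mk (wires 1) ⊠ (mk (X 1 2 0) ⨟ (mk (Z 1 0 1) ⊠ mk (Z 1 0 1)))), ← seq_assoc (mk (Z 1 2 0)) (mk (wires 1) ⊠ (mk (X 1 2 0) ⨟ (mk (Z 1 0 (-1)) ⊠ mk (Z 1 0 (-1)))))]
  -- now `X(π) ⨾ Gn ⨾ Gn₊ ⨾ X(π) ⨾ T ⨾ H`; multiply by `db 4 (-1)` twice and trade `Gn₊` for `Gn`
  refine cancel_dumbbell_four_one_one (-1) (cancel_dumbbell_four_one_one (-1) ?_)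
  conv_lhs => rw [← seq_scalar_par_one (mk (dumbbell 4 (-1))) (mk (X 1 1 4)), ← seq_scalar_par_one (mk (dumbbell 4 (-1))) (mk (X 1 1 4)),
    ← seq_scalar_par_one (mk (dumbbell 4 (-1))) (mk (Z 1 2 0) ⨟ (mk (wires 1) ⊠ (mk (X 1 2 0) ⨟ (mk (Z 1 0 (-1)) ⊠ mk (Z 1 0 (-1)))))), ← seq_scalar_par_one (mk (dumbbell 4 (-1))) (mk (Z 1 2 0) ⨟ (mk (wires 1) ⊠ (mk (X 1 2 0) ⨟ (mk (Z 1 0 (-1)) ⊠ mk (Z 1 0 (-1)))))),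
    ← scalar_par_seq_one (mk (dumbbell 4 (-1))) (mk (Z 1 2 0) ⨟ (mk (wires 1) ⊠ (mk (X 1 2 0) ⨟ (mk (Z 1 0 1) ⊠ mk (Z 1 0 1))))), ← scalar_par_seq_one (mk (dumbbell 4 (-1))) (mk (dumbbell 4 (-1)) ⊠ (mk (Z 1 2 0) ⨟ (mk (wires 1) ⊠ (mk (X 1 2 0) ⨟ (mk (Z 1 0 1) ⊠ mk (Z 1 0 1)))))), gadgetNode_plus_eq,
    scalar_par_seq_one, scalar_par_seq_one, seq_scalar_par_one, seq_scalar_par_one, seq_scalar_par_one, seq_scalar_par_one,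
    mk_triangle, seq_assoc _ (mk (xLeafL 0 1)) (mk (Z 1 1 1)), seq_assoc (mk (Z 1 2 0) ⨟ (mk (wires 1) ⊠ (mk (X 1 2 0) ⨟ (mk (Z 1 0 (-1)) ⊠ mk (Z 1 0 (-1)))))) (mk (xLeafL 0 1) ⨟ mk (Z 1 1 1)) (mk (X 1 1 2)), seq_assoc (mk (Z 1 2 0) ⨟ (mk (wires 1) ⊠ (mk (X 1 2 0) ⨟ (mk (Z 1 0 (-1)) ⊠ mk (Z 1 0 (-1)))))) (mk (xLeafL 0 1) ⨟ mk (Z 1 1 1) ⨟ mk (X 1 1 2)) (mk hBox), leafN_seq_hBox,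
    ← seq_assoc (mk (Z 1 2 0) ⨟ (mk (wires 1) ⊠ (mk (X 1 2 0) ⨟ (mk (Z 1 0 (-1)) ⊠ mk (Z 1 0 (-1)))))) (mk (X 1 1 4)) (mk (xLeafL 0 1) ⨟ mk (Z 1 1 1) ⨟ mk (X 1 1 2)), gadgetNode_seq_X_pi, ← seq_assoc (mk (X 1 1 4)) (mk (X 1 1 4) ⨟ (mk (Z 1 2 0) ⨟ (mk (wires 1) ⊠ (mk (X 1 2 4) ⨟ (mk (Z 1 0 (-1)) ⊠ mk (Z 1 0 (-1))))))) (mk (xLeafL 0 1) ⨟ mk (Z 1 1 1) ⨟ mk (X 1 1 2)), ← seq_assoc (mk (X 1 1 4)) (mk (X 1 1 4)) (mk (Z 1 2 0) ⨟ (mk (wires 1) ⊠ (mk (X 1 2 4) ⨟ (mk (Z 1 0 (-1)) ⊠ mk (Z 1 0 (-1)))))),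
    xphase_seq_xphase, show (4 : ZMod 8) + 4 = 0 from by decide, X_one_one, id_seq, ← seq_assoc (mk (Z 1 2 0) ⨟ (mk (wires 1) ⊠ (mk (X 1 2 0) ⨟ (mk (Z 1 0 (-1)) ⊠ mk (Z 1 0 (-1)))))) (mk (Z 1 2 0) ⨟ (mk (wires 1) ⊠ (mk (X 1 2 4) ⨟ (mk (Z 1 0 (-1)) ⊠ mk (Z 1 0 (-1)))))) (mk (xLeafL 0 1) ⨟ mk (Z 1 1 1) ⨟ mk (X 1 1 2)), gadgetNode_seq_gadgetNode_pi, scalar_par_seq_one, id_seq,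
    seq_scalar_par_one, seq_scalar_par_one]
  conv_rhs => rw [mk_triangle, seq_assoc _ (mk (xLeafL 0 1)) (mk (Z 1 1 1)), seq_assoc (mk (Z 1 2 0) ⨟ (mk (wires 1) ⊠ (mk (X 1 2 0) ⨟ (mk (Z 1 0 (-1)) ⊠ mk (Z 1 0 (-1)))))) (mk (xLeafL 0 1) ⨟ mk (Z 1 1 1)) (mk (X 1 1 2)),
    show ∀ Y : ZXClass 1 1, mk (dumbbell 4 (-1)) ⊠ (mk (dumbbell 4 (-1)) ⊠ Y) = (mk (dumbbell 4 (-1)) ⊠ mk (dumbbell 4 (-1))) ⊠ Y from fun Y => (par_assoc' _ _ _).trans (cast_id _ _ _),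
    dumbbell_four_mul, show (-1 : ZMod 8) + -1 = -2 from by decide,
    show ∀ Y : ZXClass 1 1, (mk (dumbbell 4 (-2)) ⊠ mk (dumbbell 0 0)) ⊠ Y = mk (dumbbell 4 (-2)) ⊠ (mk (dumbbell 0 0) ⊠ Y) from fun Y => (par_assoc _ _ _).trans (cast_id _ _ _),
    scalar_par_scalar_par (mk (dumbbell 4 (-2))) (mk (dumbbell 0 0)), scalar_par_scalar_par (mk (dumbbell 4 (-2))) (mk (dumbbell 0 0))]

end ZXClass

end Literature.Computability.QuantumComplexity
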